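import Summits.HodgeConjecture.HodgeConjecture.Theorems.F0P6aLineSpecialisation
import Literature.AlgebraicGeometry.GroupSchemes.AdmissibleIdealClosureSubscheme
import Literature.AlgebraicGeometry.GroupSchemes.EtaleHopfIdealsOfPoints
import Literature.AlgebraicGeometry.GroupSchemes.CanonicalSubgroupOfPoints
import Literature.AlgebraicGeometry.GroupSchemes.FrobeniusKillsQuotientEtale
import Literature.AlgebraicGeometry.AbelianSchemes.AbelianSchemeBaseChangeComp
import Literature.AlgebraicGeometry.AbelianSchemes.AbelianSchemeFibreFrobeniusTwist
import HarnessLib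
import HarnessLib.Audit.LibrarySuggestionsDenyListCruxes

/-!
# `F0P6aKillEngineWLayerW` — ★ RE-HOME of the crux workfile `Lines/F0_P6a_KillEngineW.lean` (tree sha16 9e31b9f7f48926b4, 992 l., 59 declaration commands, code-`sorry`-free), PART 1 of 3

This `Theorems/` module is the TREE BYTES of that workfile with the NAMESPACE KEPT, so every fully-qualified name is UNCHANGED; only this module docstring is re-headed,
the `Lines` imports are switched to their ★ re-homed twins — `Lines.F0_P6a_LineSpecialisation` → ★ `Theorems.F0P6aLineSpecialisation` — and the audit carrier `LibrarySuggestionsDenyListCruxes` is CARRIED on this root part (bare import, LEAD «M-142d» (1) rule «P-κ»; parts 2…n inherit it transitively)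
Why a re-home: a `Theorems/` file cannot import a `Lines/` workfile (F0P6-ref1 o-6), and closing stmt-HodgeConjecture-24832 `--as proved --by <Theorems decl>` at rung 0 needs the
sorry-free `Lines` chain behind the gate (RE-HOME TABLE v1.7, LA7-plan (g7); PLAN «L3 cone RE-HOME» v1, LA3-plan (g5); LEAD F0P6-plan (g5) «M-140» (1)∕(4), 2026-09-02).
SIZE LINT (`Theorems/` files with proofs ≤ 400 l.): the workfile is cut into 3 consecutive parts `F0P6aKillEngineWLayerW` → `F0P6aKillEngineWSpecialW` → `F0P6aKillEngineW`; this is PART 1 (tree lines :1–:364); each later part imports the previous one and re-opens the scopes open at its cut with their `variable`∕`open`∕`set_option` lines replayed verbatim; the LAST part `F0P6aKillEngineW` is the module the `Lines/` shim and consumers import.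
After the chain is ★ the `Lines` workfile becomes a one-import SHIM of `F0P6aKillEngineW` (a `Lines/` write, batched per cone on the LEAD՚s word), so no environment holds two copies (NO-CROSS-IMPORT).
It asserts nothing beyond what the workfile already proves.  HC_CM is proved only modulo the 7 printed citations (2 remaining: hLiu418 = stmt-HodgeConjecture-24832, h413 = stmt-HodgeConjecture-24833) until rung 0 closes; a re-home is count-neutral.

## Original module docstring (verbatim)
# LS∕L3 HOME — (CL-w) THE `w`-SIDE WITNESS: KillEngineW + (CLw-1,2,3) + the `H_w` packaging (LA1-p02 (g3); LA3-plan (g2) deal 2026-09-02T09:03:42Z, LA1-plan (g5) 09:04:10Z)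

HOME-first file `F0/P6/L1/LA1-p02/g3/KillEngineW.v1.LA1-p02g3.lean`; namespace `Summit.HodgeConjecture.HodgeConjecture.Cruxes.HLiu418.F0P6aLineSpecialisation`; imports the
SERVED LS leaflet ED. 2 + ★ only (no HOME import: §L below is LA1-p03 (g3)'s `LayerW.v1.LA1-p03g3.lean` 944412a3 BY COPY, verbatim); every declaration ≤ 400 000 heartbeats.
HC_CM is proved only modulo the 7 printed citations (2 remaining: hLiu418 = stmt-HodgeConjecture-24832, h413 = stmt-HodgeConjecture-24833) until rung 0 closes.

TARGET (frozen by LA3-p03 (g4) W7 ED. 2 cand v5 §6a `finrank_readings_of_kill_sch₀Of`, binder `hclw`, VERBATIM at `xbar := red₀Of … y`):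
`∃ (V : SchemeOver κ̄) (ν : V ⟶ (sch₀Of 𝓜 w I.univ (red₀Of … y)).X), IsClosedImmersion ν.left ∧ (∀ ⦃T⦄ t, (∃ s, s ≫ ν = t) → (∀ r ∈ 𝔭_w, t ≫ (act₀Of … r _).hom.hom.hom = 1) ∧
t ≫ q̄ = 1) ∧ p^f ≤ dim_κ̄ Γ(V)` — §W5 HEAD-W `exists_wWitness_of_kerRow` delivers it for the reduced leg `q̄` of ★ `…_kerRows` from its (K3-gen) row (text of (b′)),
the roof's (r1), a `w`-line `Hw : LineWOf I y` inside the roof kernel `K` (§W6 packages `H_w := K ∩ A_y[𝔭_w]`), under the (F1) identifications `hσΩ`∕`hσκ` (as in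
KillEngine v2 0f1eef43 §4; `rfl` on the LS ED. 3 text).  THE WITNESS: `V := V(spI J) = Spec (Γ(layerκW) ⧸ spIWOf Hw)`, `ν := quotIncl ≫ (ιRW)_{sκ} ≫ σκ⁻¹` — closed
(★ `isClosedImmersion_quotIncl_left`, ★ (S-c) kernel closed, iso), `𝔭_w`-torsion (★ (S-c) `kerι_comp_i_eq_one` at the `sκ` base change ∘ `act₀_i_comp_isoSpecialOf_hom`),
`q̄`-killed (KillEngine §1′∕§3∕(K3-gen)∕★ p849577 `quotIncl_spI_comp_eq_one_of_pullback_map` — the W-port), rank `= p^f` (★ `FrobKillEt.finrank_alg_specOver_quotient` ∘ ★ S1).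

* §L   LayerW v1 (LA1-p03 (g3) 944412a3) BY COPY: `LineWOf`, `transRW`, `layerRW`, `ιRW`, rows, `βRW`, `layerκW`, `layerΩW`, §1c-0W, `AdmKWOf`, `eLWOf`, `eLWOf_le_ker_iff`;
* §L′  κ-side twins (new): `exists_iso_layerκW_ker`, `isClosedImmersion_pullback_map_ιRW_left`, `pullback_map_ιRW_comp_i_eq_one`, `act₀Of_hom_hom_hom_eq`, `spIWOf`, `isAdm_spIWOf`;
* §W0  `satWOf`, `closureInclWOf`, `flat_closureW_hom`;  §W1 `quotIncl_eLWOf_comp_eq_one` (generic kill, `Hw ⊆ K`);  §W1′ `pullback_map_closureW_comp_eq_one`;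
* §W3  `comp_threePiece_inv_comp_eq_one_of_eq_W` (= KillEngine §3; DROP for an import when `Lines/F0_P6a_KillEngine.lean` is served);
* §W4  `pullback_map_closureW_inv_comp_eq_one_of_kerRow` (MODEL special kill at `sκ w` through `σκ⁻¹`), `quotIncl_spIWOf_comp_eq_one_of_kerRow` ((CLw-2) by `q̄`);
* §W5  HEAD-W `exists_wWitness_of_kerRow` (the `hclw` ∃-pack);  §W6 `infTorsionW`, `mem_infTorsionW_iff`, `lineWOfKernel` (`H_w` as a `LineWOf`), `lineWOfKernel_le`.
-/

set_option autoImplicit false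
set_option linter.dupNamespace false

noncomputable section

namespace Summit.HodgeConjecture.HodgeConjecture.Cruxes.HLiu418.F0P6aLineSpecialisation

open CategoryTheory CategoryTheory.Limits NumberField IsDedekindDomain MulAction AlgebraicGeometry
open scoped Matrix Polynomial Pointwise MonoidalCategory
open Literature.NumberTheory.GaloisRepresentations
open Literature.NumberTheory.Automorphic Literature.NumberTheory.Automorphic.UnitaryGroup
open Literature.AlgebraicGeometry.ShimuraVarieties.UnitaryCanonicalModel
open Literature.NumberTheory.Automorphic.Liu2021.AppendixC
open Literature.AlgebraicGeometry.Motives (AlgPoints IntegralModel SchemeOver thickening thickeningGalAction thickeningLift specOver extendPoint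
  specValuationSubring specFractionFieldι specRingHomι)
open Literature.NumberTheory.DiophantineGeometry (geomResidueField specialFibreFunctor specResidueField geomClosedPointIsoSpecResidueField
  geomResidueFieldEquiv toClosureValuationSubring)
open Literature.AlgebraicGeometry.RelativeSpec (ActionOver)
open Literature.NumberTheory.EllipticCurves (genericFibre specGenericPoint)
open Literature.AlgebraicGeometry.AbelianSchemes Literature.AlgebraicGeometry.AbelianSchemes.AbelianSchemeOver
open Literature.AlgebraicGeometry.GroupSchemes.AffineGroupScheme (Alg)
open Summit.HodgeConjecture.HodgeConjecture.Cruxes.HLiu418.F0P6aModuliDatumDefs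
open Summit.HodgeConjecture.HodgeConjecture.Cruxes.HLiu418.F0P6aRGDAssembly
open Summit.HodgeConjecture.HodgeConjecture.Cruxes.HLiu418.F0P6aDatumOfInputs

/-! ## §L  LayerW v1 (LA1-p03 (g3), `F0/P6/L1/LA1-p03/g3/LayerW.v1.LA1-p03g3.lean` sha16 944412a368bd9b2d, lines 46–497) — BY COPY, VERBATIM -/

section PresentationW

variable {F : Type} [Field F] [NumberField F]

/-- A Serre presentation of `𝔭_w` exists (★ `exists_serrePresentation_of_ideal`, the conjuncts we read). [cite: Neukirch1999, Ch. I §3 (3.8)–(3.9)] -/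
theorem exists_presW (w : HeightOneSpectrum (𝓞 F)) :
    ∃ (m : ℕ) (E : Matrix (Fin m) (Fin m) (𝓞 F)) (_ : E * E = E) (P : Matrix (Fin m) (Fin 1) (𝓞 F)) (Q : Matrix (Fin 1) (Fin m) (𝓞 F)) (N : ℕ),
      N ≠ 0 ∧ E * P = P ∧ Q * E = Q ∧ Q * P = Matrix.scalar (Fin 1) (N : 𝓞 F) ∧ P * Q = Matrix.scalar (Fin m) (N : 𝓞 F) * E ∧
      Ideal.span (Set.range fun k => P k 0) = w.asIdeal := by
  obtain ⟨m, E, hE, P, Q, N, h1, h2, h3, h4, h5, h6, -, -⟩ :=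
    Literature.NumberTheory.NumberFields.SerrePresentation.exists_serrePresentation_of_ideal
      (w.asIdeal) w.ne_bot
  exact ⟨m, E, hE, P, Q, N, h1, h2, h3, h4, h5, h6⟩

/-- the size of the CHOSEN presentation. -/
def mWOf (w : HeightOneSpectrum (𝓞 F)) : ℕ := (exists_presW w).choose

/-- the idempotent `E` of the CHOSEN presentation (`𝔟 = E·𝒪ᵐ ≅ 𝔭⁻¹`). [cite: Conrad2004GrossZagier, §7 (Thm. 7.5)] -/
def EWOf (w : HeightOneSpectrum (𝓞 F)) : Matrix (Fin (mWOf w)) (Fin (mWOf w)) (𝓞 F) := (exists_presW w).choose_spec.choose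

/-- `E² = E`. -/
theorem EWOf_idem (w : HeightOneSpectrum (𝓞 F)) : EWOf w * EWOf w = EWOf w := (exists_presW w).choose_spec.choose_spec.choose

/-- the column `P` of the CHOSEN presentation (its coordinates generate `𝔭_{c•w}`). [cite: Conrad2004GrossZagier, §7 (Thm. 7.5)] -/
def PWOf (w : HeightOneSpectrum (𝓞 F)) : Matrix (Fin (mWOf w)) (Fin 1) (𝓞 F) := (exists_presW w).choose_spec.choose_spec.choose_spec.choose

/-- the row `Q` of the CHOSEN presentation (quasi-inverse). [cite: Conrad2004GrossZagier, §7 (Thm. 7.5)] -/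
def QWOf (w : HeightOneSpectrum (𝓞 F)) : Matrix (Fin 1) (Fin (mWOf w)) (𝓞 F) :=
  (exists_presW w).choose_spec.choose_spec.choose_spec.choose_spec.choose

/-- the integer `N` of the CHOSEN presentation (`QP = N`). [cite: Conrad2004GrossZagier, §7 (Thm. 7.5)] -/
def NWOf (w : HeightOneSpectrum (𝓞 F)) : ℕ := (exists_presW w).choose_spec.choose_spec.choose_spec.choose_spec.choose_spec.choose

/-- the five laws of the CHOSEN presentation: `N ≠ 0`, `EP = P`, `QE = Q`, `QP = N`, `PQ = N·E`, `span P = 𝔭_{c•w}`. [cite: Conrad2004GrossZagier, §7 (Thm. 7.5)] -/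
theorem presW_laws (w : HeightOneSpectrum (𝓞 F)) :
    NWOf w ≠ 0 ∧ EWOf w * PWOf w = PWOf w ∧ QWOf w * EWOf w = QWOf w ∧ QWOf w * PWOf w = Matrix.scalar (Fin 1) (NWOf w : 𝓞 F) ∧
      PWOf w * QWOf w = Matrix.scalar (Fin (mWOf w)) (NWOf w : 𝓞 F) * EWOf w ∧
      Ideal.span (Set.range fun k => PWOf w k 0) = w.asIdeal :=
  (exists_presW w).choose_spec.choose_spec.choose_spec.choose_spec.choose_spec.choose_spec

end PresentationW

section LayerW

set_option synthInstance.maxHeartbeats 100000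

open Literature.AlgebraicGeometry.GroupSchemes (GroupSchemeKernel.ker GroupSchemeKernel.kerι)

variable {F : Type} [Field F] [NumberField F] [IsCMField F] {ι₁ : F →+* ℂ}
    {Jstar : Matrix (Fin 2) (Fin 2) F}
    {K₀ : C5.OpenCompactSubgroup ↥(finAdelic ↥(maximalRealSubfield F) F (IsCMField.complexConj F) 2 Jstar)}
    {S : RecordSystemGS F Jstar ι₁ K₀} {hU7ₛ : S.HeckeTranslateDefinedOver}
    {hJ : (Jstar.map (IsCMField.complexConj F))ᵀ = Jstar} {hJu : IsUnit Jstar}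
    {Fi : Type} [Field Fi] [Algebra F Fi] {Kc : C5.SmallLevel K₀} {G : Type} [Group G]
    {𝓜 : IntegralModel (𝓞 F) F ((thickening F Fi).obj (S.M.obj Kc))}
    {w : HeightOneSpectrum (𝓞 F)} {hw : (IsCMField.complexConj F) • w ≠ w} {h𝓨 : (𝓜.localise w).IsSmoothProper 1}
    {θ : ActionOver (𝓜.localise w).total.hom ((Fi ≃ₐ[F] Fi) × G)}
    {e : Fi →ₐ[F] AlgebraicClosure (w.adicCompletion F)}

variable (I : RGDInputsAt F ι₁ Jstar K₀ S hU7ₛ hJ hJu Fi Kc G 𝓜 w hw h𝓨 θ e)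

/-- **`LineWOf I y`** — THE `w`-TWIN OF THE D-LINE's `LineOf I y`: the `𝒪_F`-stable subgroups of order `q = p^f` of `A_y(Ω̄)` killed by `𝔭_w` (instead of `𝔭_{c•w}`).  The use:
`H_w := K ∩ A_y[𝔭_w]` for a roof kernel `K` served by `RoofLink` (order `q` by LA2-p03's `natCard_roofKernel_inf_idealTorsionΩ_w_eq`, stable by `roofKernel_stable`).
[cite: Liu2021, Prop. D.8 p. 135] [cite: Tate1997FiniteFlatGroupSchemes, (3.7)] -/
def LineWOf (y : AlgPoints (S.M.obj Kc) (AlgebraicClosure (w.adicCompletion F))) : Type :=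
  {H : Subgroup ((fibreΩOf S Kc 𝓜 w e I.univ y).Points (AlgebraicClosure (w.adicCompletion F))) //
    Nat.card ↥H = I.pChar ^ I.fDeg ∧
    (∀ P ∈ H, IsIdealTorsionΩ S Kc 𝓜 w e I.univ I.act y w.asIdeal P) ∧
    ∀ (a : 𝓞 F), ∀ P ∈ H, (AlgPoints.map (actΩOf S Kc 𝓜 w e I.univ I.act a y).hom.hom.hom P :
      (fibreΩOf S Kc 𝓜 w e I.univ y).Points (AlgebraicClosure (w.adicCompletion F))) ∈ H}

/-- **the ideal translation `ψ_P : famOf I y ⟶ famOf I y ⊗_𝒪 𝔟`** of the CHOSEN presentation of `𝔭_{c•w}` (explicit instance: `isCommMonObj_famOf I y`).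
[cite: Conrad2004GrossZagier, §7 (Thm. 7.5)] -/
abbrev transRW (y : AlgPoints (S.M.obj Kc) (AlgebraicClosure (w.adicCompletion F))) :=
  @serreTranslate _ (famOf I y) (𝓞 F) _ (actFamOf I y) (isCommMonObj_famOf I y) (mWOf w) (EWOf w) (EWOf_idem w) (PWOf w)

/-- `ψ_P` is a homomorphism (★ `isMonHom_serreTranslate`) — the instance under which ★ `grpObjKer` makes `layerR I y` a group scheme; supply it with
`haveI := isMonHom_transRW I y`. [cite: Conrad2004GrossZagier, §7 (Thm. 7.5)] -/
theorem isMonHom_transRW (y : AlgPoints (S.M.obj Kc) (AlgebraicClosure (w.adicCompletion F))) : IsMonHom (transRW I y) := by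
  haveI := isCommMonObj_famOf I y
  exact isMonHom_serreTranslate (actFamOf I y) (EWOf w) (EWOf_idem w) (PWOf w)

/-- **`layerR I y := Ker ψ_P = (univ ×_𝓨 Spec R)[𝔭_{c•w}]`** — the (S-c) `𝔭_{c•w}`-torsion layer of the lifted family over `R = 𝒪_Ω̄` (★ finite flat closed subgroup, kernel-of-`𝔭`
clause on all points, commutes with base change).  Its group structure is ★ `grpObjKer` under `haveI := isMonHom_transRW I y`. [cite: Conrad2004GrossZagier, §7 (Thm. 7.5)]
[cite: Tate1997FiniteFlatGroupSchemes, (3.7)] -/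
abbrev layerRW (y : AlgPoints (S.M.obj Kc) (AlgebraicClosure (w.adicCompletion F))) : SchemeOver ↥(closureValuationSubring (w.adicCompletion F)) :=
  GroupSchemeKernel.ker (transRW I y)

/-- **`ιR I y : layerRW I y ↪ famOf I y`** (★ `kerι`: a monomorphic homomorphism, ★ `mono_kerι` ∕ `isMonHom_kerι`). [cite: GortzWedhorn2020, Definition 4.45 (2), p. 117] -/
abbrev ιRW (y : AlgPoints (S.M.obj Kc) (AlgebraicClosure (w.adicCompletion F))) : layerRW I y ⟶ (famOf I y).X :=
  GroupSchemeKernel.kerι (transRW I y)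

/-- `layerR I y` is affine (★ (S-c) `isAffine_ker_left`). [cite: GortzWedhorn2023, Cor. 27.177 (1)] -/
theorem isAffine_layerRW_left (y : AlgPoints (S.M.obj Kc) (AlgebraicClosure (w.adicCompletion F))) : IsAffine (layerRW I y).left := by
  haveI := isCommMonObj_famOf I y
  exact IdealTorsion.isAffine_ker_left (actFamOf I y) (EWOf w) (EWOf_idem w) (PWOf w) (QWOf w) (presW_laws w).1 (presW_laws w).2.1 (presW_laws w).2.2.1 (presW_laws w).2.2.2.1 (presW_laws w).2.2.2.2.1

/-- `layerR I y → Spec R` is finite (★ (S-c) `isFinite_ker_hom`). [cite: GortzWedhorn2023, Cor. 27.177 (1)] -/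
theorem isFinite_layerRW_hom (y : AlgPoints (S.M.obj Kc) (AlgebraicClosure (w.adicCompletion F))) : IsFinite (layerRW I y).hom := by
  haveI := isCommMonObj_famOf I y
  exact IdealTorsion.isFinite_ker_hom (actFamOf I y) (EWOf w) (EWOf_idem w) (PWOf w) (QWOf w) (presW_laws w).1 (presW_laws w).2.1 (presW_laws w).2.2.1 (presW_laws w).2.2.2.1 (presW_laws w).2.2.2.2.1

/-- `layerR I y → Spec R` is flat (★ (S-c) `flat_ker_hom`). [cite: MumfordFogartyKirwan1994, Ch. 6 §2 Lemma 6.12 (p. 122)] -/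
theorem flat_layerRW_hom (y : AlgPoints (S.M.obj Kc) (AlgebraicClosure (w.adicCompletion F))) : Flat (layerRW I y).hom := by
  haveI := isCommMonObj_famOf I y
  exact IdealTorsion.flat_ker_hom (actFamOf I y) (EWOf w) (EWOf_idem w) (PWOf w) (QWOf w) (presW_laws w).1 (presW_laws w).2.1 (presW_laws w).2.2.1 (presW_laws w).2.2.2.1 (presW_laws w).2.2.2.2.1

/-- `Γ(layerRW I y)` is a finite `R`-module (★ (GF) `moduleFinite_alg_ker`). [cite: Tate1997FiniteFlatGroupSchemes, (3.7)] -/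
theorem moduleFinite_alg_layerRW (y : AlgPoints (S.M.obj Kc) (AlgebraicClosure (w.adicCompletion F))) : Module.Finite ↥(closureValuationSubring (w.adicCompletion F)) (Alg (layerRW I y)) := by
  haveI := isCommMonObj_famOf I y
  exact IdealTorsion.moduleFinite_alg_ker (actFamOf I y) (EWOf w) (EWOf_idem w) (PWOf w) (QWOf w) (presW_laws w).1 (presW_laws w).2.1 (presW_laws w).2.2.1 (presW_laws w).2.2.2.1 (presW_laws w).2.2.2.2.1

/-- `Γ(layerRW I y)` is a flat `R`-module (★ (GF) `moduleFlat_alg_ker`). [cite: EGAIV2, §2.8 (Prop. 2.8.5)] -/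
theorem moduleFlat_alg_layerRW (y : AlgPoints (S.M.obj Kc) (AlgebraicClosure (w.adicCompletion F))) : Module.Flat ↥(closureValuationSubring (w.adicCompletion F)) (Alg (layerRW I y)) := by
  haveI := isCommMonObj_famOf I y
  exact IdealTorsion.moduleFlat_alg_ker (actFamOf I y) (EWOf w) (EWOf_idem w) (PWOf w) (QWOf w) (presW_laws w).1 (presW_laws w).2.1 (presW_laws w).2.2.1 (presW_laws w).2.2.2.1 (presW_laws w).2.2.2.2.1

/-- `Γ(layerRW I y)` is a free `R`-module (★ (GF) `moduleFree_alg_ker`, `R` local). [cite: StacksProject, Tag 00NZ] -/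
theorem moduleFree_alg_layerRW (y : AlgPoints (S.M.obj Kc) (AlgebraicClosure (w.adicCompletion F))) : Module.Free ↥(closureValuationSubring (w.adicCompletion F)) (Alg (layerRW I y)) := by
  haveI := isCommMonObj_famOf I y
  exact IdealTorsion.moduleFree_alg_ker (actFamOf I y) (EWOf w) (EWOf_idem w) (PWOf w) (QWOf w) (presW_laws w).1 (presW_laws w).2.1 (presW_laws w).2.2.1 (presW_laws w).2.2.2.1 (presW_laws w).2.2.2.2.1

set_option maxHeartbeats 400000 in
/-- the (S-c-β) action package on `layerR I y` (★ `exists_action`: intertwined along `ιR`, homomorphic). [cite: Conrad2004GrossZagier, §7 (Thm. 7.5)] -/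
theorem exists_βRW (y : AlgPoints (S.M.obj Kc) (AlgebraicClosure (w.adicCompletion F))) :
    haveI := isMonHom_transRW I y
    ∃ β : 𝓞 F → (layerRW I y ⟶ layerRW I y), (∀ a, β a ≫ ιRW I y = ιRW I y ≫ (actFamOf I y).i a) ∧ ∀ a, IsMonHom (β a) := by
  haveI := isCommMonObj_famOf I y
  obtain ⟨β, h1, h2, -⟩ :=
    IdealTorsion.exists_action (actFamOf I y) (EWOf w) (EWOf_idem w) (PWOf w) (presW_laws w).2.1 (presW_laws w).2.2.2.2.2
  exact ⟨β, h1, h2⟩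

/-- **the `𝒪_F`-action `βR I y` on `layerR I y`**, lifting `ι(a)` along `ιR` (CHOSEN from `exists_βR`). [cite: Conrad2004GrossZagier, §7 (Thm. 7.5)] -/
def βRW (y : AlgPoints (S.M.obj Kc) (AlgebraicClosure (w.adicCompletion F))) : 𝓞 F → (layerRW I y ⟶ layerRW I y) :=
  (exists_βRW I y).choose

/-- `βR a` lies over `ι(a)`: `βR a ≫ ιRW = ιRW ≫ (actFamOf I y).i a`. [cite: Kottwitz1992, §5, p. 390] -/
theorem βRW_comp_ιRW (y : AlgPoints (S.M.obj Kc) (AlgebraicClosure (w.adicCompletion F))) (a : 𝓞 F) : βRW I y a ≫ ιRW I y = ιRW I y ≫ (actFamOf I y).i a :=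
  (exists_βRW I y).choose_spec.1 a

/-- `βR a` is a homomorphism. [cite: Kottwitz1992, §5, p. 390] -/
theorem isMonHom_βRW (y : AlgPoints (S.M.obj Kc) (AlgebraicClosure (w.adicCompletion F))) (a : 𝓞 F) : haveI := isMonHom_transRW I y; IsMonHom (βRW I y a) :=
  (exists_βRW I y).choose_spec.2 a

end LayerW

/-! ### §1a′ the two fibres of the layer and the CHOSEN presentation isos -/

section FibresW

set_option synthInstance.maxHeartbeats 100000

open Literature.AlgebraicGeometry.GroupSchemes (GroupSchemeKernel.ker GroupSchemeKernel.kerι)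


variable {F : Type} [Field F] [NumberField F] [IsCMField F] {ι₁ : F →+* ℂ}
    {Jstar : Matrix (Fin 2) (Fin 2) F}
    {K₀ : C5.OpenCompactSubgroup ↥(finAdelic ↥(maximalRealSubfield F) F (IsCMField.complexConj F) 2 Jstar)}
    {S : RecordSystemGS F Jstar ι₁ K₀} {hU7ₛ : S.HeckeTranslateDefinedOver}
    {hJ : (Jstar.map (IsCMField.complexConj F))ᵀ = Jstar} {hJu : IsUnit Jstar}
    {Fi : Type} [Field Fi] [Algebra F Fi] {Kc : C5.SmallLevel K₀} {G : Type} [Group G]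
    {𝓜 : IntegralModel (𝓞 F) F ((thickening F Fi).obj (S.M.obj Kc))}
    {w : HeightOneSpectrum (𝓞 F)} {hw : (IsCMField.complexConj F) • w ≠ w} {h𝓨 : (𝓜.localise w).IsSmoothProper 1}
    {θ : ActionOver (𝓜.localise w).total.hom ((Fi ≃ₐ[F] Fi) × G)}
    {e : Fi →ₐ[F] AlgebraicClosure (w.adicCompletion F)}

variable (I : RGDInputsAt F ι₁ Jstar K₀ S hU7ₛ hJ hJu Fi Kc G 𝓜 w hw h𝓨 θ e)

/-- **`layerκ I y := layerRW I y ×_R κ̄(w)`** — the special fibre of the layer (group structure: Mathlib's transported one, scoped `CategoryTheory.Obj`, under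
`haveI := isMonHom_transRW I y`). [cite: Tate1997FiniteFlatGroupSchemes, (3.7)] -/
abbrev layerκW (y : AlgPoints (S.M.obj Kc) (AlgebraicClosure (w.adicCompletion F))) : SchemeOver (geomResidueField w) :=
  (Over.pullback (sκ w)).obj (layerRW I y)

/-- **`layerΩ I y := layerRW I y ×_R Ω̄`** — the generic geometric fibre of the layer. [cite: Tate1997FiniteFlatGroupSchemes, (3.7)] -/
abbrev layerΩW (y : AlgPoints (S.M.obj Kc) (AlgebraicClosure (w.adicCompletion F))) : SchemeOver (AlgebraicClosure (w.adicCompletion F)) :=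
  (Over.pullback (sΩ w)).obj (layerRW I y)

/-- `layerκ I y` is affine (base change of the affine `layerR I y` to a field). [cite: GortzWedhorn2023, Cor. 27.177 (1)] -/
theorem isAffine_layerκW_left (y : AlgPoints (S.M.obj Kc) (AlgebraicClosure (w.adicCompletion F))) : IsAffine (layerκW I y).left := by
  haveI := isFinite_layerRW_hom I y
  haveI : IsFinite (layerκW I y).hom := MorphismProperty.pullback_snd _ _ inferInstance
  exact isAffine_of_isAffineHom (layerκW I y).hom

/-- `layerΩ I y` is affine. [cite: GortzWedhorn2023, Cor. 27.177 (1)] -/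
theorem isAffine_layerΩW_left (y : AlgPoints (S.M.obj Kc) (AlgebraicClosure (w.adicCompletion F))) : IsAffine (layerΩW I y).left := by
  haveI := isFinite_layerRW_hom I y
  haveI : IsFinite (layerΩW I y).hom := MorphismProperty.pullback_snd _ _ inferInstance
  exact isAffine_of_isAffineHom (layerΩW I y).hom


end FibresW

section GenericW

set_option synthInstance.maxHeartbeats 100000

open Literature.AlgebraicGeometry.GroupSchemes (GroupSchemeKernel.ker GroupSchemeKernel.kerι)
open Literature.AlgebraicGeometry.GroupSchemes.AffineGroupScheme (ptEquiv)

variable {F : Type} [Field F] [NumberField F] [IsCMField F] {ι₁ : F →+* ℂ}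
    {Jstar : Matrix (Fin 2) (Fin 2) F}
    {K₀ : C5.OpenCompactSubgroup ↥(finAdelic ↥(maximalRealSubfield F) F (IsCMField.complexConj F) 2 Jstar)}
    {S : RecordSystemGS F Jstar ι₁ K₀} {hU7ₛ : S.HeckeTranslateDefinedOver}
    {hJ : (Jstar.map (IsCMField.complexConj F))ᵀ = Jstar} {hJu : IsUnit Jstar}
    {Fi : Type} [Field Fi] [Algebra F Fi] {Kc : C5.SmallLevel K₀} {G : Type} [Group G]
    {𝓜 : IntegralModel (𝓞 F) F ((thickening F Fi).obj (S.M.obj Kc))}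
    {w : HeightOneSpectrum (𝓞 F)} {hw : (IsCMField.complexConj F) • w ≠ w} {h𝓨 : (𝓜.localise w).IsSmoothProper 1}
    {θ : ActionOver (𝓜.localise w).total.hom ((Fi ≃ₐ[F] Fi) × G)}
    {e : Fi →ₐ[F] AlgebraicClosure (w.adicCompletion F)}

variable (I : RGDInputsAt F ι₁ Jstar K₀ S hU7ₛ hJ hJu Fi Kc G 𝓜 w hw h𝓨 θ e)

/-! #### §1c-0 the generic layer: finite étale, its inclusion into `(univ ×_𝓨 Spec R) ×_R Ω̄` a monomorphic homomorphism reading the `𝔭_{c•w}`-torsion -/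

set_option backward.isDefEq.respectTransparency false in
/-- `layerΩ I y → Spec Ω̄` is finite (base change of the finite `layerR I y → Spec R`). [cite: GortzWedhorn2023, Cor. 27.177 (1)] -/
theorem isFinite_layerΩW_hom (y : AlgPoints (S.M.obj Kc) (AlgebraicClosure (w.adicCompletion F))) : IsFinite (layerΩW I y).hom := by
  haveI := isFinite_layerRW_hom I y
  exact MorphismProperty.pullback_snd _ _ inferInstance

set_option maxHeartbeats 400000 in
open scoped MonObj CategoryTheory.Obj in
set_option backward.isDefEq.respectTransparency false in
/-- **★ (S-c) §3 READ FOR THE LAYER**: `layerΩ I y ≅ (A_Ω̄)[𝔭_{c•w}] = Ker ψ_P(A_Ω̄)` over `A_Ω̄ := (univ ×_𝓨 Spec R) ×_R Ω̄`, compatibly with `(ιRW)_Ω̄` and `kerι`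
(★ `IdealTorsion.exists_baseChange_iso` at `g := sΩ w`). [cite: GortzWedhorn2020, (4.15), p. 116 and Definition 4.45 (2), p. 117] [cite: Conrad2004GrossZagier, §7 (Thm. 7.5)] -/
theorem exists_iso_layerΩW_ker (y : AlgPoints (S.M.obj Kc) (AlgebraicClosure (w.adicCompletion F))) :
    haveI := isCommMonObj_famOf I y
    ∃ eg : layerΩW I y ≅
        GroupSchemeKernel.ker (@serreTranslate _ ((famOf I y).baseChange (sΩ w)) (𝓞 F) _ ((actFamOf I y).baseChange (sΩ w))
          (isCommMonObj_baseChange (sΩ w)) (mWOf w) (EWOf w) (EWOf_idem w) (PWOf w)),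
      eg.hom ≫ GroupSchemeKernel.kerι _ = (Over.pullback (sΩ w)).map (ιRW I y) := by
  haveI := isCommMonObj_famOf I y
  exact IdealTorsion.exists_baseChange_iso (actFamOf I y) (EWOf w) (EWOf_idem w) (PWOf w) (sΩ w) (presW_laws w).2.1

set_option maxHeartbeats 400000 in
open scoped MonObj CategoryTheory.Obj in
set_option backward.isDefEq.respectTransparency false in
/-- **THE KERNEL-OF-`𝔭` CLAUSE THROUGH `(ιRW)_Ω̄`**: a `T`-point `t` of `A_Ω̄ = (univ ×_𝓨 Spec R) ×_R Ω̄` factors through `(ιRW)_Ω̄ : layerΩW I y ⟶ A_Ω̄` iff it is killed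
by every `ι(a)`, `a ∈ 𝔭_{c•w}` (★ (S-c) `exists_comp_kerι_eq_iff_forall_mem` at the base-changed family, moved along `exists_iso_layerΩ_ker`).
[cite: Conrad2004GrossZagier, §7 (Thm. 7.5)] [cite: GortzWedhorn2020, Definition 4.45 (2), p. 117] -/
theorem exists_comp_pullback_map_ιRW_iff (y : AlgPoints (S.M.obj Kc) (AlgebraicClosure (w.adicCompletion F)))
    {T : Over (Spec (.of (AlgebraicClosure (w.adicCompletion F))))} (t : T ⟶ ((famOf I y).baseChange (sΩ w)).X) :
    (∃ s : T ⟶ layerΩW I y, s ≫ (Over.pullback (sΩ w)).map (ιRW I y) = t) ↔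
      ∀ a ∈ w.asIdeal, t ≫ ((actFamOf I y).baseChange (sΩ w)).i a = 1 := by
  haveI := isCommMonObj_famOf I y
  haveI : IsCommMonObj ((famOf I y).baseChange (sΩ w)).X := isCommMonObj_baseChange _
  obtain ⟨eg, heg⟩ := exists_iso_layerΩW_ker I y
  rw [← IdealTorsion.exists_comp_kerι_eq_iff_forall_mem ((actFamOf I y).baseChange (sΩ w)) (EWOf w) (EWOf_idem w) (PWOf w)
    (presW_laws w).2.1 (presW_laws w).2.2.2.2.2 t, ← heg]
  constructor
  · rintro ⟨s, hs⟩
    exact ⟨s ≫ eg.hom, by rw [Category.assoc]; exact hs⟩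
  · rintro ⟨s', hs'⟩
    exact ⟨s' ≫ eg.inv, by rw [Category.assoc, Iso.inv_hom_id_assoc]; exact hs'⟩

set_option maxHeartbeats 400000 in
open scoped MonObj CategoryTheory.Obj in
set_option backward.isDefEq.respectTransparency false in
/-- `(ιRW)_Ω̄ : layerΩW I y ⟶ A_Ω̄` is a monomorphism (an isomorphism followed by ★ `mono_kerι`). [cite: GortzWedhorn2020, Definition 4.45 (2), p. 117] -/
theorem mono_pullback_map_ιRW (y : AlgPoints (S.M.obj Kc) (AlgebraicClosure (w.adicCompletion F))) :
    Mono ((Over.pullback (sΩ w)).map (ιRW I y)) := by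
  haveI := isCommMonObj_famOf I y
  obtain ⟨eg, heg⟩ := exists_iso_layerΩW_ker I y
  rw [← heg]
  haveI := Literature.AlgebraicGeometry.GroupSchemes.GroupSchemeKernel.mono_kerι (@serreTranslate _ ((famOf I y).baseChange (sΩ w)) (𝓞 F) _ ((actFamOf I y).baseChange (sΩ w))
    (isCommMonObj_baseChange (sΩ w)) (mWOf w) (EWOf w) (EWOf_idem w) (PWOf w))
  exact mono_comp _ _

set_option maxHeartbeats 400000 in
open scoped MonObj CategoryTheory.Obj in
set_option backward.isDefEq.respectTransparency false in
/-- **THE GENERIC LAYER IS ÉTALE**: `layerΩ I y → Spec Ω̄` is étale — `(A_Ω̄)[𝔭]` is étale over the characteristic-`0` field `Ω̄` (★ (GF)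
`etale_ker_serreTranslate_hom`, `(N : Ω̄) ≠ 0`), and `layerΩ I y ≅ (A_Ω̄)[𝔭]` over `Spec Ω̄`. [cite: MumfordAV1970, §7 Thm. 4 (p. 72)] [cite: GortzWedhorn2023, Prop. 27.187 and Cor. 27.63] -/
theorem etale_layerΩW_hom (y : AlgPoints (S.M.obj Kc) (AlgebraicClosure (w.adicCompletion F))) : Etale (layerΩW I y).hom := by
  haveI := isCommMonObj_famOf I y
  haveI : IsCommMonObj ((famOf I y).baseChange (sΩ w)).X := isCommMonObj_baseChange _
  have hN : ((NWOf w : ℕ) : AlgebraicClosure (w.adicCompletion F)) ≠ 0 := Nat.cast_ne_zero.mpr (presW_laws w).1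
  haveI := IdealTorsion.etale_ker_serreTranslate_hom ((actFamOf I y).baseChange (sΩ w)) (EWOf w) (EWOf_idem w) (PWOf w) (QWOf w)
    hN (presW_laws w).2.1 (presW_laws w).2.2.2.1
  obtain ⟨eg, -⟩ := exists_iso_layerΩW_ker I y
  haveI : IsIso eg.hom.left := inferInstanceAs (IsIso ((Over.forget _).map eg.hom))
  rw [← Over.w eg.hom]
  infer_instance

set_option maxHeartbeats 400000 in
open scoped MonObj CategoryTheory.Obj in
set_option backward.isDefEq.respectTransparency false in
/-- `(βRW a)_Ω̄` and `ι(a)_Ω̄` are INTERTWINED by `(ιRW)_Ω̄` (base change of `βR_comp_ιR`). [cite: Kottwitz1992, §5, p. 390] -/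
theorem pullback_map_βRW_comp (y : AlgPoints (S.M.obj Kc) (AlgebraicClosure (w.adicCompletion F))) (a : 𝓞 F) :
    (Over.pullback (sΩ w)).map (βRW I y a) ≫ (Over.pullback (sΩ w)).map (ιRW I y) =
      (Over.pullback (sΩ w)).map (ιRW I y) ≫ ((actFamOf I y).baseChange (sΩ w)).i a := by
  rw [← Functor.map_comp, βRW_comp_ιRW, Functor.map_comp]
  rfl

open scoped MonObj CategoryTheory.Obj in
/-- **`AdmKOf I y J`** — `J ⊂ Γ(layerΩW I y)` is ADMISSIBLE: Hopf over `Ω̄`, corank `q = p^f`, stable under every `Γ((βRW a)_Ω̄)` — LITERALLY the hypothesis triple `hJ` of ★ S1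
`isHopfIdeal_and_finrank_and_map_le_spI` at `G := layerRW I y`, `K := Ω̄`, `β := βRW I y`, `r := q` (and of ★ (E-b4′)∕SP-SURJ).  [cite: Tate1997FiniteFlatGroupSchemes, (3.7)]
[cite: GortzWedhorn2023, §(27.2) (27.2.1) (pp. 606–607)] -/
def AdmKWOf (y : AlgPoints (S.M.obj Kc) (AlgebraicClosure (w.adicCompletion F))) (J : Ideal (Alg (layerΩW I y))) : Prop :=
  haveI := isMonHom_transRW I y
  haveI := isAffine_layerΩW_left I y
  J.IsHopfIdeal (AlgebraicClosure (w.adicCompletion F)) ∧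
    Module.finrank (AlgebraicClosure (w.adicCompletion F)) (Alg (layerΩW I y) ⧸ J) = I.pChar ^ I.fDeg ∧
    ∀ a : 𝓞 F, J.map ((Over.pullback (sΩ w)).map (βRW I y a)).left.appTop.hom ≤ J


/-! (★ re-home, size lint: PART 1 of 3 ends here at tree line :364; the workfile continues, in the same namespace, in `Theorems/F0P6aKillEngineWSpecialW.lean`.) -/

end GenericW
end Summit.HodgeConjecture.HodgeConjecture.Cruxes.HLiu418.F0P6aLineSpecialisation
end
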